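/-
Copyright (c) 2026 the pub-hodgecm-mathlib formalisation cell (harness21).  Prover seat hodgecm-mathlib-K2Liu-p25 (g2), Track B «K2-LIT» ∕ hLiu418
#184♮ = `stmt-HodgeConjecture-24832`, socket #41 — ORGAN (T) companion: `IsStd` TRANSPORTS UNDER CONJUGATION (LEAD F0P6-plan (g14) RULING «M-158j» road (R-c),
BATCH #70 (1) ∕ #72 (1)(b)).  THEOREMS ONLY (no `def`, no instance, no notation, no `sorry`).
-/
import Summits.HodgeConjecture.HodgeConjecture.Theorems.K2LiuSiegelEisensteinRightTranslation   -- ★ (T) `exists_iwasawaDatum_conj` (the conjugate datum's membership shape)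
import Literature.NumberTheory.K2Lit.SiegelStandardIwasawaData                                 -- ★ `IwasawaDatum.IsStd` ((P0)(P1)(P2))
import HarnessLib

/-!
# Crux `HLiu418`, socket #41, ORGAN (T) companion: A CONJUGATE OF A STANDARD IWASAWA DATUM IS STANDARD

Cell `hodgecm-mathlib`, crux item hLiu418 = `stmt-HodgeConjecture-24832`; squad K2 ∕ K2Liu (L1, LEAD F0P6-plan (g14)); prover K2Liu-p25 (g2).  THEOREMS ONLY; lane
`--supports stmt-HodgeConjecture-24832 --as helper`.

★ (T) `K2LiuSiegelEisensteinRightTranslation.exists_iwasawaDatum_conj` gives, for an Iwasawa datum `𝒦` and `x ∈ H(𝔸)`, an Iwasawa datum `𝒦′` with `k ∈ 𝒦′.K ↔ x⁻¹ k x ∈ 𝒦.K`.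
THIS FILE: if `𝒦` is STANDARD (★ `IwasawaDatum.IsStd`: `𝒦.K = C_∞ · C_f` read through ★ `archPart` ∕ `finPart`, `C_f` open, `C_∞ = H_∞ ∩ S·U(1)·S⁻¹` the stabiliser of a majorant
with `J′J′ = 1` for `J′ = (σS)ᵀ(J^𝔻⊗1)S`) then so is `𝒦′`: **`isStd_of_conj`** with `C_∞′ := x_∞ C_∞ x_∞⁻¹`, `C_f′ := x_f C_f x_f⁻¹`, frame `S′ := x_∞ · S` — (P0) by the
multiplicativity of ★ `archPart` ∕ `finPart`; (P1) conjugation is a homeomorphism of `H(𝔸_f)`; (P2) the transported form is UNCHANGED, `(σ(x_∞S))ᵀ (J^𝔻⊗1) (x_∞S) = (σS)ᵀ (J^𝔻⊗1) S`,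
because `x_∞ ∈ U(J^𝔻)(L ⊗ ℝ)` (★ `UnitaryGroup.mem_arch_iff`), and `a′ ∈ C_∞′ ↔ (x_∞S)⁻¹ a′ (x_∞S) ∈ U(1)`.  Hence socket #41's `∀ 𝒦, 𝒦.IsStd → …` is closed under the
(T) transport: `isStd_conj_of_isStd` packages ★ `exists_iwasawaDatum_conj` + `isStd_of_conj`.
References: [BorelJacquet1979, §4.1]; [Weil1964, Chap. I n° 8]; [Tan1999, §1 p. 166]; [MoeglinWaldspurger1995, I.2.1].
HONEST LABEL.  Count-neutral helper: `HC_CM` is proved only modulo the 7 printed citations (2 remaining named inputs: hLiu418 = `stmt-HodgeConjecture-24832`,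
h413 = `stmt-HodgeConjecture-24833`) until rung 0 closes; this file closes no socket.
-/

set_option autoImplicit false
set_option linter.dupNamespace false -- the mandated namespace repeats `HodgeConjecture.HodgeConjecture`

noncomputable section

open scoped Matrix
open NumberField NumberField.mixedEmbedding
open Literature.NumberTheory.Automorphic Literature.NumberTheory.GaloisRepresentations
open Literature.NumberTheory.GelbartRogawski1991 Literature.NumberTheory.GelbartRogawski1991.GRConstruction
open Literature.NumberTheory.K2Lit.SiegelDoubled

namespace Summit.HodgeConjecture.HodgeConjecture.Cruxes.HLiu418.K2LiuIwasawaDatumConjStd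

open Summit.HodgeConjecture.HodgeConjecture.Cruxes.HLiu418.K2LiuSiegelEisensteinRightTranslation (exists_iwasawaDatum_conj)

variable {L : Type} [Field L] [NumberField L] [IsCMField L]
variable {N M n : ℕ} {e : Fin N × Fin M ≃ Fin n}
  {dV : Fin N → L} {hdV : ∀ i, IsCMField.complexConj L (dV i) = dV i}
  {dW : Fin M → L} {hdW : ∀ i, IsCMField.complexConj L (dW i) = dW i}

/-- **THE TRANSPORTED FORM IS UNCHANGED BY AN ARCHIMEDEAN UNITARY FACTOR**: for `a ∈ U(J^𝔻)(L ⊗ ℝ)` (★ `UnitaryGroup.mem_arch_iff`: `(σa)ᵀ(J^𝔻⊗1)a = J^𝔻⊗1`) and any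
frame `S`, `(σ(aS))ᵀ (J^𝔻⊗1) (aS) = (σS)ᵀ (J^𝔻⊗1) S`. [cite: Weil1964, Chap. I n° 8] [cite: BorelJacquet1979, §4.1] -/
theorem transportedForm_arch_mul (a : UnitaryGroup.arch (Fp L) L (IsCMField.complexConj L) (n + n) (hermD L e dV hdV dW hdW))
    (S : GL (Fin (n + n)) (mixedSpace L)) :
    ((((a : GL (Fin (n + n)) (mixedSpace L)) * S : GL (Fin (n + n)) (mixedSpace L)) : Matrix (Fin (n + n)) (Fin (n + n)) (mixedSpace L)).map
          (UnitaryGroup.conjMixed (Fp L) L (IsCMField.complexConj L)))ᵀ *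
        UnitaryGroup.archFormOf L (n + n) (hermD L e dV hdV dW hdW) *
        (((a : GL (Fin (n + n)) (mixedSpace L)) * S : GL (Fin (n + n)) (mixedSpace L)) : Matrix (Fin (n + n)) (Fin (n + n)) (mixedSpace L)) =
      ((S : Matrix (Fin (n + n)) (Fin (n + n)) (mixedSpace L)).map (UnitaryGroup.conjMixed (Fp L) L (IsCMField.complexConj L)))ᵀ *
        UnitaryGroup.archFormOf L (n + n) (hermD L e dV hdV dW hdW) * (S : Matrix (Fin (n + n)) (Fin (n + n)) (mixedSpace L)) := by
  have ha := (UnitaryGroup.mem_arch_iff (Fp L) L (IsCMField.complexConj L) (n + n) (hermD L e dV hdV dW hdW) (a : GL (Fin (n + n)) (mixedSpace L))).1 a.2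
  set A : Matrix (Fin (n + n)) (Fin (n + n)) (mixedSpace L) := ((a : GL (Fin (n + n)) (mixedSpace L)) : Matrix (Fin (n + n)) (Fin (n + n)) (mixedSpace L)) with hA
  set T : Matrix (Fin (n + n)) (Fin (n + n)) (mixedSpace L) := (S : Matrix (Fin (n + n)) (Fin (n + n)) (mixedSpace L)) with hT
  set F : Matrix (Fin (n + n)) (Fin (n + n)) (mixedSpace L) := UnitaryGroup.archFormOf L (n + n) (hermD L e dV hdV dW hdW) with hF
  rw [Units.val_mul, Matrix.map_mul, Matrix.transpose_mul]
  calc (T.map (UnitaryGroup.conjMixed (Fp L) L (IsCMField.complexConj L)))ᵀ * (A.map (UnitaryGroup.conjMixed (Fp L) L (IsCMField.complexConj L)))ᵀ * F * (A * T)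
        = (T.map (UnitaryGroup.conjMixed (Fp L) L (IsCMField.complexConj L)))ᵀ *
            ((A.map (UnitaryGroup.conjMixed (Fp L) L (IsCMField.complexConj L)))ᵀ * F * A) * T := by
          simp only [Matrix.mul_assoc]
    _ = (T.map (UnitaryGroup.conjMixed (Fp L) L (IsCMField.complexConj L)))ᵀ * F * T := by rw [ha]

/-- **A CONJUGATE OF A STANDARD IWASAWA DATUM IS STANDARD** (`IsStd` transports): if `𝒦` is standard and `𝒦′.K = x 𝒦.K x⁻¹` (membership `k ∈ 𝒦′.K ↔ x⁻¹ k x ∈ 𝒦.K`) for some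
`x ∈ H(𝔸)`, then `𝒦′` is standard, with `C_∞′ = x_∞ C_∞ x_∞⁻¹`, `C_f′ = x_f C_f x_f⁻¹` and the frame `S′ = x_∞ S` ((P0) ★ `archPart`∕`finPart` are homomorphisms; (P1) conjugation is a
homeomorphism; (P2) `transportedForm_arch_mul` and `(x_∞S)⁻¹ a′ (x_∞S) = S⁻¹(x_∞⁻¹ a′ x_∞)S`). [cite: BorelJacquet1979, §4.1] [cite: Weil1964, Chap. I n° 8] [cite: Tan1999, §1 p. 166] -/
theorem isStd_of_conj {𝒦 𝒦' : IwasawaDatum L e dV hdV dW hdW} (h𝒦 : 𝒦.IsStd) (x : HA L e dV hdV dW hdW)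
    (hK' : ∀ k : HA L e dV hdV dW hdW, k ∈ 𝒦'.K ↔ x⁻¹ * k * x ∈ 𝒦.K) : 𝒦'.IsStd := by
  obtain ⟨Cinf, Cfin, S, hmem, hopen, hmaj, harch⟩ := h𝒦
  set a := UnitaryGroup.archPart (Fp L) L (IsCMField.complexConj L) (n + n) (hermD L e dV hdV dW hdW) x with ha
  set b := UnitaryGroup.finPart (Fp L) L (IsCMField.complexConj L) (n + n) (hermD L e dV hdV dW hdW) x with hb
  have hmemA : ∀ u, u ∈ Cinf.comap (MulAut.conj a⁻¹).toMonoidHom ↔ a⁻¹ * u * a ∈ Cinf := fun u => by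
    rw [Subgroup.mem_comap, MulEquiv.coe_toMonoidHom, MulAut.conj_apply, inv_inv]
  have hmemF : ∀ u, u ∈ Cfin.comap (MulAut.conj b⁻¹).toMonoidHom ↔ b⁻¹ * u * b ∈ Cfin := fun u => by
    rw [Subgroup.mem_comap, MulEquiv.coe_toMonoidHom, MulAut.conj_apply, inv_inv]
  refine ⟨Cinf.comap (MulAut.conj a⁻¹).toMonoidHom, Cfin.comap (MulAut.conj b⁻¹).toMonoidHom,
    (a : GL (Fin (n + n)) (mixedSpace L)) * S, fun k => ?_, ?_, ?_, fun a' => ?_⟩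
  · -- (P0) (★ `archPart`∕`finPart` are homomorphisms; syntactic forms for `rw` on the `HA`-products)
    have hAm : ∀ k k' : HA L e dV hdV dW hdW, UnitaryGroup.archPart (Fp L) L (IsCMField.complexConj L) (n + n) (hermD L e dV hdV dW hdW) (k * k' : HA L e dV hdV dW hdW) =
        UnitaryGroup.archPart (Fp L) L (IsCMField.complexConj L) (n + n) (hermD L e dV hdV dW hdW) k *
          UnitaryGroup.archPart (Fp L) L (IsCMField.complexConj L) (n + n) (hermD L e dV hdV dW hdW) k' := fun k k' => map_mul _ _ _
    have hAi : ∀ k : HA L e dV hdV dW hdW, UnitaryGroup.archPart (Fp L) L (IsCMField.complexConj L) (n + n) (hermD L e dV hdV dW hdW) (k⁻¹ : HA L e dV hdV dW hdW) =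
        (UnitaryGroup.archPart (Fp L) L (IsCMField.complexConj L) (n + n) (hermD L e dV hdV dW hdW) k)⁻¹ := fun k => map_inv _ _
    have hFm : ∀ k k' : HA L e dV hdV dW hdW, UnitaryGroup.finPart (Fp L) L (IsCMField.complexConj L) (n + n) (hermD L e dV hdV dW hdW) (k * k' : HA L e dV hdV dW hdW) =
        UnitaryGroup.finPart (Fp L) L (IsCMField.complexConj L) (n + n) (hermD L e dV hdV dW hdW) k *
          UnitaryGroup.finPart (Fp L) L (IsCMField.complexConj L) (n + n) (hermD L e dV hdV dW hdW) k' := fun k k' => map_mul _ _ _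
    have hFi : ∀ k : HA L e dV hdV dW hdW, UnitaryGroup.finPart (Fp L) L (IsCMField.complexConj L) (n + n) (hermD L e dV hdV dW hdW) (k⁻¹ : HA L e dV hdV dW hdW) =
        (UnitaryGroup.finPart (Fp L) L (IsCMField.complexConj L) (n + n) (hermD L e dV hdV dW hdW) k)⁻¹ := fun k => map_inv _ _
    rw [hK' k, hmem, hmemA, hmemF, hAm, hAm, hAi, hFm, hFm, hFi]
  · -- (P1): the preimage of the open `C_f` under the continuous `u ↦ b⁻¹ u b`
    have hset : ((Cfin.comap (MulAut.conj b⁻¹).toMonoidHom :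
        Subgroup (UnitaryGroup.finAdelic (Fp L) L (IsCMField.complexConj L) (n + n) (hermD L e dV hdV dW hdW))) :
          Set (UnitaryGroup.finAdelic (Fp L) L (IsCMField.complexConj L) (n + n) (hermD L e dV hdV dW hdW))) =
        (fun u => b⁻¹ * u * b) ⁻¹' (Cfin : Set (UnitaryGroup.finAdelic (Fp L) L (IsCMField.complexConj L) (n + n) (hermD L e dV hdV dW hdW))) := by
      ext u
      rw [SetLike.mem_coe, hmemF, Set.mem_preimage, SetLike.mem_coe]
    rw [hset]
    exact hopen.preimage ((continuous_const.mul continuous_id).mul continuous_const)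
  · -- (P2), majorant identity: the transported form is unchanged
    rw [transportedForm_arch_mul]
    exact hmaj
  · -- (P2), stabiliser: `a′ ∈ C_∞′ ↔ (aS)⁻¹ a′ (aS) ∈ U(1)`
    rw [hmemA, harch (a⁻¹ * a' * a)]
    have hEq : S⁻¹ * ((a⁻¹ * a' * a : UnitaryGroup.arch (Fp L) L (IsCMField.complexConj L) (n + n) (hermD L e dV hdV dW hdW)) : GL (Fin (n + n)) (mixedSpace L)) * S =
        ((a : GL (Fin (n + n)) (mixedSpace L)) * S)⁻¹ * (a' : GL (Fin (n + n)) (mixedSpace L)) * ((a : GL (Fin (n + n)) (mixedSpace L)) * S) := by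
      rw [Subgroup.coe_mul, Subgroup.coe_mul, Subgroup.coe_inv, mul_inv_rev]
      group
    rw [hEq]

variable (L e dV hdV dW hdW) in
/-- **STANDARD DATA ARE CLOSED UNDER CONJUGATION** (★ (T) `exists_iwasawaDatum_conj` + `isStd_of_conj`): for `𝒦` standard and `x ∈ H(𝔸)` there is a STANDARD Iwasawa datum `𝒦′` with
`k ∈ 𝒦′.K ↔ x⁻¹ k x ∈ 𝒦.K` — the datum socket #41's `∀ 𝒦, 𝒦.IsStd → …` is transported along by ★ (T) `continuation_transport`. [cite: BorelJacquet1979, §4.1] [cite: Tan1999, §1 p. 166] -/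
theorem exists_isStd_conj {𝒦 : IwasawaDatum L e dV hdV dW hdW} (h𝒦 : 𝒦.IsStd) (x : HA L e dV hdV dW hdW) :
    ∃ 𝒦' : IwasawaDatum L e dV hdV dW hdW, 𝒦'.IsStd ∧ ∀ k : HA L e dV hdV dW hdW, k ∈ 𝒦'.K ↔ x⁻¹ * k * x ∈ 𝒦.K := by
  obtain ⟨𝒦', h𝒦'⟩ := exists_iwasawaDatum_conj L e dV hdV dW hdW 𝒦 x
  exact ⟨𝒦', isStd_of_conj h𝒦 x h𝒦', h𝒦'⟩

end Summit.HodgeConjecture.HodgeConjecture.Cruxes.HLiu418.K2LiuIwasawaDatumConjStd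

end
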